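import Mathlib
import Summits.ValiantsHypothesis.ValiantsHypothesis.Theorems.LacunarySymmetroidMatrixDescartesCensusDefs
import Summits.ValiantsHypothesis.ValiantsHypothesis.Theorems.LacunarySymmetroidMatrixDescartesStubPerturbGeneric
import Summits.ValiantsHypothesis.ValiantsHypothesis.Theorems.SymmetroidPencilBasics

/-!
# Tower graft line, stub S3: the dissociation reduction (blow-up monotonicity of support-level root bounds)

By-name closer for the registered stub S3 `stub_dissociationReduction : DissociationReduction` of the line
`Cruxes/WeakLifting/Lines/tower_graft.lean` (commit 93fc8a4763ba; crux `WeakLifting` = stmt-ValiantsHypothesis-19561,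
restricted sub-case `TowerWeakLifting`; line planner val-idea-24 g0, critic val-idea-crit-6 g0, lead g27 R2667 (B)), with the
line's `IsDissociated m e` hypothesis inlined (and, as the planner notes, unused):

`dissociation_reduction`: if every BLOWN-UP support `l ↦ N·d l + e l` (`N > m·e l`) carries the positive-root bound `B` for all
real symmetric `m × m` pencils, then the support `d` carries the bound `2B + 1` (in fact `2B`).

PROOF (the route located by val-idea-24 g0 in the tree).  (i) `tendsto_det_blowup`: for `t > 0`,
`det (∑ l (t^{1/M})^{M·d l + e l} • S l) → det (∑ l t^{d l} • S l)` as `M → ∞` (`(t^{1/M})^{M a + b} = t^a · t^{b/M}` and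
`t^{b/M} → 1`).  (ii) Hence an `N`-alternation certificate `τ` of `(d, S')` is, for all large `M`, an `N`-alternation
certificate `j ↦ (τ j)^{1/M}` of `(M·d + e, S')`, so `N ≤ B` by `le_card_posRoots_of_alternating` and the hypothesis at `M`.
(iii) The tree's fixed-support perturbation theorem `Perturb.perturbToAlternation` (generic rank-one direction + Jacobi) turns
the certificate bound `B` into the root bound `2B` for every symmetric pencil on `d`.

Def-free; the line discharges S3 by `exact dissociation_reduction`.  HONEST FRAMING: a chamber-reduction joint of a skeleton
for a RESTRICTED sub-case; nothing here bears on `WeakLifting` itself, on Conjecture B / `KPlusLogSqLaw`, on `MatrixDescartes`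
(18050) or on `VP ≠ VNP`.  Seat: prover val-sym-lift-p2 g17, `--supports stmt-ValiantsHypothesis-19561`.
-/

-- `Summit.ValiantsHypothesis.ValiantsHypothesis.…` repeats a component by the D-0017 layout
-- (single-conjunct summit), which the `dupNamespace` linter flags; the name is mandated.
set_option linter.dupNamespace false

namespace Summit.ValiantsHypothesis.ValiantsHypothesis.Theorems.KPlusLogSqLaw.TowerGraft

open Filter Topology Polynomial
open Summit.ValiantsHypothesis.ValiantsHypothesis.Theorems.LacunarySymmetroidMatrixDescartes (PosRootLawOn)
open Summit.ValiantsHypothesis.ValiantsHypothesis.Theorems.SymmetroidDescartes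
  (eval_det_pencil le_card_posRoots_of_alternating)

/-- The blow-up power identity: `(t^{1/M})^{M a + b} = t^a · t^{b/M}` for `t > 0`, `M ≥ 1`. [folklore] -/
theorem rpow_blowup (t : ℝ) (ht : 0 < t) (M a b : ℕ) (hM : 0 < M) :
    (t ^ ((1 : ℝ) / M)) ^ (M * a + b) = t ^ a * t ^ ((b : ℝ) / M) := by
  rw [← Real.rpow_natCast, ← Real.rpow_mul ht.le]
  have hM' : (M : ℝ) ≠ 0 := Nat.cast_ne_zero.mpr hM.ne'
  have : (1 : ℝ) / M * ((M * a + b : ℕ) : ℝ) = (a : ℝ) + (b : ℝ) / M := by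
    push_cast
    field_simp
  rw [this, Real.rpow_add ht, Real.rpow_natCast]

/-- **Blow-up limit.**  For `t > 0`: `det (∑ l (t^{1/M})^{M·d l + e l} • S l) → det (∑ l t^{d l} • S l)` as `M → ∞`. [folklore] -/
theorem tendsto_det_blowup {m K : ℕ} (d e : Fin K → ℕ) (S : Fin K → Matrix (Fin m) (Fin m) ℝ) (t : ℝ)
    (ht : 0 < t) :
    Tendsto (fun M : ℕ => (∑ l, (t ^ ((1 : ℝ) / M)) ^ (M * d l + e l) • S l).det) atTop
      (𝓝 ((∑ l, t ^ d l • S l).det)) := by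
  have hmat : Tendsto (fun M : ℕ => ∑ l, (t ^ ((1 : ℝ) / M)) ^ (M * d l + e l) • S l) atTop
      (𝓝 (∑ l, t ^ d l • S l)) := by
    apply tendsto_finsetSum
    intro l _
    refine Filter.Tendsto.smul_const ?_ (S l)
    have h1 : Tendsto (fun M : ℕ => t ^ d l * t ^ ((e l : ℝ) / M)) atTop (𝓝 (t ^ d l * t ^ (0 : ℝ))) := by
      refine tendsto_const_nhds.mul ?_
      have hc : Continuous (fun x : ℝ => t ^ x) := Real.continuous_const_rpow ht.ne'
      exact (hc.tendsto 0).comp (tendsto_const_div_atTop_nhds_zero_nat (e l : ℝ))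
    rw [Real.rpow_zero, mul_one] at h1
    refine h1.congr' ?_
    filter_upwards [Filter.eventually_gt_atTop 0] with M hM
    rw [rpow_blowup t ht M (d l) (e l) hM]
  have hdet : Continuous fun A : Matrix (Fin m) (Fin m) ℝ => A.det := continuous_id.matrix_det
  exact (hdet.tendsto _).comp hmat

/-- **Certificates climb the blow-up.**  If every blown-up support `M·d + e` (`M > m·e l`) carries the positive-root
bound `B` for all symmetric pencils, then every `N`-alternation certificate of a symmetric pencil on `d` has `N ≤ B`. [this work] -/
theorem certificate_le_of_blowup_law (m K B : ℕ) (d e : Fin K → ℕ)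
    (hlaw : ∀ N : ℕ, (∀ l, m * e l < N) → PosRootLawOn m K B (fun l => N * d l + e l))
    (S : Fin K → Matrix (Fin m) (Fin m) ℝ) (hS : ∀ l, (S l).IsSymm) (N : ℕ) (τ : Fin (N + 1) → ℝ)
    (hτ : StrictMono τ) (hpos : ∀ j, 0 < τ j)
    (halt : ∀ j : Fin N,
      (∑ l, (Polynomial.X : ℝ[X]) ^ d l • (S l).map Polynomial.C).det.eval (τ j.castSucc) *
        (∑ l, (Polynomial.X : ℝ[X]) ^ d l • (S l).map Polynomial.C).det.eval (τ j.succ) < 0) :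
    N ≤ B := by
  classical
  have halt' : ∀ j : Fin N,
      (∑ l, τ j.castSucc ^ d l • S l).det * (∑ l, τ j.succ ^ d l • S l).det < 0 := by
    intro j
    have := halt j
    rwa [eval_det_pencil, eval_det_pencil] at this
  have hlim : ∀ j : Fin (N + 1), Tendsto
      (fun M : ℕ => (∑ l, ((τ j) ^ ((1 : ℝ) / M)) ^ (M * d l + e l) • S l).det) atTop
      (𝓝 ((∑ l, τ j ^ d l • S l).det)) := fun j => tendsto_det_blowup d e S (τ j) (hpos j)
  have hev : ∀ᶠ M : ℕ in atTop, ∀ j : Fin N,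
      (∑ l, ((τ j.castSucc) ^ ((1 : ℝ) / M)) ^ (M * d l + e l) • S l).det *
        (∑ l, ((τ j.succ) ^ ((1 : ℝ) / M)) ^ (M * d l + e l) • S l).det < 0 :=
    Filter.eventually_all.mpr fun j => ((hlim j.castSucc).mul (hlim j.succ)).eventually (eventually_lt_nhds (halt' j))
  have hevE : ∀ᶠ M : ℕ in atTop, ∀ l, m * e l < M :=
    Filter.eventually_all.mpr fun l => Filter.eventually_gt_atTop _
  obtain ⟨M, ⟨hM, hME⟩, hMpos⟩ := ((hev.and hevE).and (Filter.eventually_gt_atTop 0)).exists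
  have hMr : (0 : ℝ) < 1 / (M : ℝ) := by
    have : (0 : ℝ) < M := Nat.cast_pos.mpr hMpos
    positivity
  set τ' : Fin (N + 1) → ℝ := fun j => (τ j) ^ ((1 : ℝ) / M) with hτ'
  have hτ'mono : StrictMono τ' := fun i j hij => Real.rpow_lt_rpow (hpos i).le (hτ hij) hMr
  have hpos' : ∀ j, 0 < τ' j := fun j => Real.rpow_pos_of_pos (hpos j) _
  have hcount := le_card_posRoots_of_alternating
    ((∑ l, (Polynomial.X : ℝ[X]) ^ (M * d l + e l) • (S l).map Polynomial.C).det) N τ' hτ'mono hpos'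
    (fun j => by rw [eval_det_pencil, eval_det_pencil]; exact hM j)
  exact hcount.trans (hlaw M hME S hS)

/-- **S3 `stub_dissociationReduction` (verbatim, `IsDissociated` inlined — and not needed).**  A support-level positive-root
bound `B` on every blown-up support `M·d + e` (`M > m·e l`) gives the bound `2B + 1` on `d`: certificates climb the
blow-up (`certificate_le_of_blowup_law`) and the tree's fixed-support perturbation theorem `Perturb.perturbToAlternation`
converts the certificate bound into the root bound `2B`. [this work] -/
theorem dissociation_reduction : ∀ (m K B : ℕ) (d e : Fin K → ℕ),
    (∀ n n' : Fin K → ℕ, ∑ l, n l = m → ∑ l, n' l = m → ∑ l, n l * e l = ∑ l, n' l * e l → n = n') →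
    (∀ N : ℕ, (∀ l, m * e l < N) → PosRootLawOn m K B (fun l => N * d l + e l)) →
    PosRootLawOn m K (2 * B + 1) d := by
  intro m K B d e _ hlaw S hS
  refine (Summit.ValiantsHypothesis.ValiantsHypothesis.Theorems.LacunarySymmetroidMatrixDescartes.Perturb.perturbToAlternation
    K m d B (fun S' hS' N τ h => ?_) S hS).trans (by omega)
  exact certificate_le_of_blowup_law m K B d e hlaw S' hS' N τ h.1 h.2.1 h.2.2

end Summit.ValiantsHypothesis.ValiantsHypothesis.Theorems.KPlusLogSqLaw.TowerGraft
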